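import Literature.Computability.QuantumComplexity.GenKit
import Literature.Computability.QuantumComplexity.CoreDescBlockFP
import HarnessLib

/-!
# The sizes of the general gadget kit in polynomial time

Topic `Literature/Computability/QuantumComplexity`; an input of the UNIFORMITY of Regev's sampler ([Regev2009, Lemma 3.14,
proof]; Arora–Barak §6.2, proof of Thm. 6.15). The general kit `GenKit.kit ps dsz k` (`GenKit.lean`) has `gR ps k`
registers, `gF ps k` flags and `gT ps k` instruction slots, the maxima of the AJL letter bounds `BlockKit.kitR/kitF/kitT k`
(on codes: `AJLCore.kitR_codeFP` …, `CoreDescSLPCodes.lean`; unary arithmetic `AJLCore.BP.uadd/umul`, `CoreDescBlockFP.lean`) and of the requirements of the extra programs `ps`. For the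
Grover–Rudolph stage `ps = [GRWord.prog k]` is a singleton (`GRData.ps`), so the three sizes are computed in polynomial
time from `1ᵏ` as soon as the compiler output of the one program is (`GRLevelProgFP.lean`, `GRWord.prog_compile_codeFP`):

* `GenKit.gR_singleton`, `gF_singleton`, `gT_singleton` — `gR [b] k = max (kitR k) (b.compile (thrWd k) 0 0).2.2.1` etc.;
* **`GenKit.gR_codeFP_of`**, **`gF_codeFP_of`**, **`gT_codeFP_of`** — from `CodeFP eσ unE k` and
  `CodeFP eσ outBE (fun c => (b c).compile (thrWd (k c)) 0 0)` to `CodeFP eσ unE (fun c => gR [b c] (k c))` etc.;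
* `GenKit.regionSize_codeFP_of`, `GenKit.bsize_codeFP_of` — the region size and the block size `bsize [b c] (dsz c) (k c)` in unary.

Everything is proved; no named fact is introduced.

## References

* O. Regev, J. ACM 56(6) (2009), Lemma 3.14 (proof) [Regev2009].
* S. Arora, B. Barak, *Computational Complexity: A Modern Approach*, CUP 2009, §1.3, §6.2 [AroraBarak2009].
-/

noncomputable section

namespace Literature.Computability.QuantumComplexity

open _root_.Computability Complexity Complexity.CodeFP SLP

namespace GenKit

/-- [folklore] -/
theorem gR_singleton (b : BExpr) (k : ℕ) : gR [b] k = max (BlockKit.kitR k) (b.compile (thrWd k) 0 0).2.2.1 := by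
  simp [gR, psR, BlockKit.lmax]

/-- [folklore] -/
theorem gF_singleton (b : BExpr) (k : ℕ) : gF [b] k = max (BlockKit.kitF k) (b.compile (thrWd k) 0 0).2.2.2 := by
  simp [gF, psF, BlockKit.lmax]

/-- [folklore] -/
theorem gT_singleton (b : BExpr) (k : ℕ) : gT [b] k = max (BlockKit.kitT k) (b.compile (thrWd k) 0 0).1.length := by
  simp [gT, psT, BlockKit.lmax]

variable {σ : Type} {eσ : σ → List Bool} {k : σ → ℕ} {b : σ → BExpr}

/-- **Registers of a one-program kit on codes.** [cite: AroraBarak2009, §6.2 (proof of Thm. 6.15)] -/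
theorem gR_codeFP_of (hk : CodeFP eσ unE k) (hb : CodeFP eσ AJLCore.outBE (fun c => (b c).compile (thrWd (k c)) 0 0)) :
    CodeFP eσ unE (fun c => gR [b c] (k c)) :=
  (AJLCore.unMax.comp ((AJLCore.kitR_codeFP.comp hk).pair hb.snd'.snd'.fst') :).congr fun c => by rw [gR_singleton]

/-- **Flags of a one-program kit on codes.** [cite: AroraBarak2009, §6.2 (proof of Thm. 6.15)] -/
theorem gF_codeFP_of (hk : CodeFP eσ unE k) (hb : CodeFP eσ AJLCore.outBE (fun c => (b c).compile (thrWd (k c)) 0 0)) :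
    CodeFP eσ unE (fun c => gF [b c] (k c)) :=
  (AJLCore.unMax.comp ((AJLCore.kitF_codeFP.comp hk).pair hb.snd'.snd'.snd') :).congr fun c => by rw [gF_singleton]

/-- **Instruction slots of a one-program kit on codes.** [cite: AroraBarak2009, §6.2 (proof of Thm. 6.15)] -/
theorem gT_codeFP_of (hk : CodeFP eσ unE k) (hb : CodeFP eσ AJLCore.outBE (fun c => (b c).compile (thrWd (k c)) 0 0)) :
    CodeFP eσ unE (fun c => gT [b c] (k c)) :=
  (AJLCore.unMax.comp ((AJLCore.kitT_codeFP.comp hk).pair ((ulength AJLCore.instrE).comp hb.fst')) :).congr fun c => by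
    rw [gT_singleton]

/-- `1ᵏ ↦ 1^{thrWd k}`. [folklore] -/
theorem thrWd_codeFP : CodeFP unE unE thrWd := (AJLCore.affUn 4 16).congr fun k => by simp [thrWd]

/-- `1ʷ ↦ 1^{scrSize w}`. [folklore] -/
theorem scrSize_codeFP : CodeFP unE unE scrSize := (AJLCore.affUn 3 1).congr fun w => by simp [scrSize]

/-- **The region size of a one-program kit on codes.** [folklore] -/
theorem regionSize_codeFP_of (hk : CodeFP eσ unE k) (hb : CodeFP eσ AJLCore.outBE (fun c => (b c).compile (thrWd (k c)) 0 0)) :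
    CodeFP eσ unE (fun c => regionSize [b c] (k c)) :=
  (AJLCore.BP.uadd (AJLCore.BP.uadd (AJLCore.BP.umul (gR_codeFP_of hk hb) (thrWd_codeFP.comp hk)) (gF_codeFP_of hk hb))
    (AJLCore.BP.umul (gT_codeFP_of hk hb) (scrSize_codeFP.comp (thrWd_codeFP.comp hk)))).congr fun c => by rw [regionSize]

/-- **The block size of a one-program kit on codes.** [folklore] -/
theorem bsize_codeFP_of {dsz : σ → ℕ} (hd : CodeFP eσ unE dsz) (hk : CodeFP eσ unE k)
    (hb : CodeFP eσ AJLCore.outBE (fun c => (b c).compile (thrWd (k c)) 0 0)) :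
    CodeFP eσ unE (fun c => bsize [b c] (dsz c) (k c)) := by
  have hreg := regionSize_codeFP_of hk hb
  have hrb : CodeFP eσ unE (fun c => rb [b c] (dsz c) (k c)) :=
    (AJLCore.BP.uadd (AJLCore.BP.uadd (AJLCore.BP.uadd hd (AJLCore.BP.uconst eσ 2)) hk) (AJLCore.BP.uadd hk hreg)).congr fun c => by
      simp only [rb, dataOff]
  exact (AJLCore.BP.uadd hrb hreg).congr fun c => by rw [bsize]

end GenKit

end Literature.Computability.QuantumComplexity

end
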